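import Literature.MathematicalPhysics.QuantumFieldTheory.Balaban1983to89.B6QGQCoerciveKLevelV1L0
import HarnessLib

/-!
# `Balaban1983to89.B6QGQTestBumpsKLevelV1L3` — SUB-ROW G-F3′-L0∕L3 (every odd `L ≥ 3`; plan `lit-balaban-r03/G-F3L0-PLAN.md` §13, joint J12, blueprint
`lit-balaban-r03/J12-BUDGET.md` v2): the part of `B6QGQTestBumpsKLevelV1L0` that carried the hypothesis `4 ≤ ℓ` (`L ≥ 5`), re-derived WITHOUT it.

statement-level skeleton of published theorems with citation tags; proofs where landed; nothing here is a claim about the Yang–Mills mass gap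

T. Bałaban, *Propagators and renormalization transformations for lattice gauge theories. II*, Commun. Math. Phys. **96** (1984) 223–250
[Balaban1984PropagatorsII], (2.147) p. 248 «⟨B,(QGQ*)B⟩ ≥ γ₀‖B‖² with a positive constant γ₀ depending on d and L only» — print states it for EVERY odd `L`;
the lineage's explicit tent realisation (`B6QGQTestBumpsKLevelV1(L0)`) used `L ≥ 5` through the tent radius `r = ⌊L^j/5⌋ ≥ 1`.  At `L = 3`, level `j = 1`,
`L^j = 3 < 5` and `r = 0`: with the level-0 twin's definitions KEPT VERBATIM (`ctr`, `erad = max r 1`, `tauL`, `bump` — imported BY NAME, joint J14) the bump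
`φ_i` is the spike on the LAST slice of the source block (case A, `b₋ ∈ Ω_j`) or on slice `0` of the target block (case B), and the closed form
`m_i = c_Q·(L^j − r)·Στ·(Στ_⊥)^d` of `mass_eq` is FALSE in case B (`ctr = r − 1` truncates at `0`).  THIS FILE proves the `ctr`-level forms valid for ALL
odd `L ≥ 3`: the mass coefficient `mc_i := ctr + 1` (A) / `L^j − 1 − ctr` (B), `m_i = c_Q·mc_i·Στ·(Στ_⊥)^d` (`mass_eq_coeff`), `1 ≤ mc_i` (`mass_pos_all`), the
same-level partner pairing `= c_Q·(L^j − mc_i)·Στ·(Στ_⊥)^d` (`partner_eq_coeff`) and its size: `≤ ½·m_i` always (`partner_le_half`), `≤ ¼·m_i` when `1 ≤ r`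
(`partner_le_quarter`), `= 0` in case A when `r = 0` (`partner_eq_zero_of_caseA`) — the inputs of the L = 3 dominance budget (J12-BUDGET §2).  Every
definition and every unchanged lemma is `B6QGQTestBumpsKLevelV1L0`'s, consumed BY NAME; no `def … : Prop`, no new fact; standard axioms.
Unit `lit-balaban-r03` (B6 fold owner, r03 gen 37), 2026-08-27; referee ref-4.  NOT summit progress.
-/

namespace Literature.MathematicalPhysics.QuantumFieldTheory.Balaban1983to89.B6QGQTestBumpsKLevelV1L3

open Literature.MathematicalPhysics.QuantumFieldTheory.Balaban1983to89.B6QGQTestBumpsKLevelV1 (Tsum Tsum_pos iterBlock_injective)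
open Literature.MathematicalPhysics.QuantumFieldTheory.Balaban1983to89.B6QGQCoerciveKLevelV1 (iterBlock_eq_of_mem)
open Literature.MathematicalPhysics.QuantumFieldTheory.Balaban1983to89.B6QGQCoerciveKLevelV1L0 (same_level_block)
open Literature.MathematicalPhysics.QuantumFieldTheory.Balaban1983to89.B6QGQTestBumpsKLevelV1L0 (rad erad ctr tauL tsumL tsumL_pos bump five_mul_rad_le ctr_fit' pair_src pair_tgt
  base_eq_src_of base_eq_tgt_of one_le_lvl_of_not_mem rad_eq_zero_of_lvl witness_of_pair_ne_zero)
open scoped InnerProductSpace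
open LatticeFieldCalculus
open B6SectAOperatorsV1 (QE BondIdx)
open B5Eq118OneStroke (iterBlock)
open B6MultiLevelBoxOperator (N0)
open B6MultiLevelTorusOperatorL0 (TDomains)
open B6GlobalChartV1 (PV)
open B6GlobalChartV1L0 (domT)
open B6Ineq2142KLevelV1 (cQ cQ_pos shift_injective)
open B6Ineq2142KLevelV1L0 (lvl lvl_le_mK base)

noncomputable section

variable {d ℓ m K : ℕ} {hd : 1 ≤ d + 1} {hL : Odd (ℓ + 1) ∧ 1 < ℓ + 1}
variable {Mh k R : ℕ} {P' : Fin (d + 1) → ℕ}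
variable (hN : ∀ μ, N0 ℓ Mh k P' μ = (PV d ℓ m K hd hL).sitesPerDir 0) (D : TDomains d ℓ Mh k P' R) (hk : k ≤ m + K)

/-! ## §1  The mass and leak coefficients at the level of `ctr` (no hypothesis on `L`) -/

/-- **THE MASS COEFFICIENT** `mc_i`: `ctr + 1` when the base block is the source block (case A), `L^j − 1 − ctr` when it is the target block (case B);
`= L^j − r` whenever `r ≥ 1` or in case A, `= L^j − 1` in case B with `r = 0` (`L = 3`, `j = 1`). [cite: Balaban1984PropagatorsII, (2.147) p.248, bookkeeping ours] -/
def mc (i : BondIdx (domT hN D hk)) : ℝ :=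
  if i.1.2.src ∈ (domT hN D hk).Om (lvl hN D hk i) then (ctr hN D hk i : ℝ) + 1
  else (((ℓ + 1) ^ (lvl hN D hk i) : ℕ) : ℝ) - 1 - ctr hN D hk i

/-- case A value. [cite: Balaban1984PropagatorsII, (2.147) p.248, bookkeeping] -/
theorem mc_caseA (i : BondIdx (domT hN D hk)) (hA : i.1.2.src ∈ (domT hN D hk).Om (lvl hN D hk i)) :
    mc hN D hk i = (ctr hN D hk i : ℝ) + 1 := by unfold mc; rw [if_pos hA]

/-- case B value. [cite: Balaban1984PropagatorsII, (2.147) p.248, bookkeeping] -/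
theorem mc_caseB (i : BondIdx (domT hN D hk)) (hB : i.1.2.src ∉ (domT hN D hk).Om (lvl hN D hk i)) :
    mc hN D hk i = (((ℓ + 1) ^ (lvl hN D hk i) : ℕ) : ℝ) - 1 - ctr hN D hk i := by unfold mc; rw [if_neg hB]

/-- in case A, `mc = L^j − r` exactly. [cite: Balaban1984PropagatorsII, (2.147) p.248, bookkeeping] -/
theorem mc_caseA_eq (i : BondIdx (domT hN D hk)) (hA : i.1.2.src ∈ (domT hN D hk).Om (lvl hN D hk i)) :
    mc hN D hk i = (((ℓ + 1) ^ (lvl hN D hk i) : ℕ) : ℝ) - rad hN D hk i := by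
  rw [mc_caseA hN D hk i hA]
  have h5 := five_mul_rad_le hN D hk i
  have hS : 1 ≤ (ℓ + 1) ^ (lvl hN D hk i) := Nat.one_le_pow _ _ (by omega)
  have hc : ctr hN D hk i = (ℓ + 1) ^ (lvl hN D hk i) - 1 - rad hN D hk i := by unfold ctr; rw [if_pos hA]
  rw [hc, Nat.cast_sub (by omega), Nat.cast_sub hS]; push_cast; ring

/-- in case B with `1 ≤ r`, `mc = L^j − r`. [cite: Balaban1984PropagatorsII, (2.147) p.248, bookkeeping] -/
theorem mc_caseB_eq (i : BondIdx (domT hN D hk)) (hB : i.1.2.src ∉ (domT hN D hk).Om (lvl hN D hk i)) (hr : 1 ≤ rad hN D hk i) :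
    mc hN D hk i = (((ℓ + 1) ^ (lvl hN D hk i) : ℕ) : ℝ) - rad hN D hk i := by
  rw [mc_caseB hN D hk i hB]
  have hc : ctr hN D hk i = rad hN D hk i - 1 := by unfold ctr; rw [if_neg hB]
  rw [hc, Nat.cast_sub hr]; push_cast; ring

/-- in case B with `r = 0` (only `L = 3`, `j = 1`), `mc = L^j − 1`. [cite: Balaban1984PropagatorsII, (2.147) p.248, bookkeeping] -/
theorem mc_caseB_eq_of_rad_eq_zero (i : BondIdx (domT hN D hk)) (hB : i.1.2.src ∉ (domT hN D hk).Om (lvl hN D hk i)) (hr : rad hN D hk i = 0) :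
    mc hN D hk i = (((ℓ + 1) ^ (lvl hN D hk i) : ℕ) : ℝ) - 1 := by
  rw [mc_caseB hN D hk i hB]
  have hc : ctr hN D hk i = rad hN D hk i - 1 := by unfold ctr; rw [if_neg hB]
  rw [hc, hr]; push_cast; ring

/-- `L^j − r ≥ 1` and `L^j ≥ 1`. [cite: Balaban1984PropagatorsII, (2.147) p.248, bookkeeping] -/
theorem one_le_pow_sub_rad (i : BondIdx (domT hN D hk)) : (1 : ℝ) ≤ (((ℓ + 1) ^ (lvl hN D hk i) : ℕ) : ℝ) - rad hN D hk i := by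
  have h5 := five_mul_rad_le hN D hk i
  have hS : 1 ≤ (ℓ + 1) ^ (lvl hN D hk i) := Nat.one_le_pow _ _ (by omega)
  have h1 : rad hN D hk i + 1 ≤ (ℓ + 1) ^ (lvl hN D hk i) := by omega
  have h2 : (rad hN D hk i : ℝ) + 1 ≤ (((ℓ + 1) ^ (lvl hN D hk i) : ℕ) : ℝ) := by exact_mod_cast h1
  linarith

/-- **`mc ≥ 1`** (case B forces `j ≥ 1`, so `L^j ≥ 3`). [cite: Balaban1984PropagatorsII, (2.147) p.248, bookkeeping] -/
theorem one_le_mc (i : BondIdx (domT hN D hk)) : 1 ≤ mc hN D hk i := by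
  by_cases hA : i.1.2.src ∈ (domT hN D hk).Om (lvl hN D hk i)
  · rw [mc_caseA_eq hN D hk i hA]; exact one_le_pow_sub_rad hN D hk i
  · by_cases hr : 1 ≤ rad hN D hk i
    · rw [mc_caseB_eq hN D hk i hA hr]; exact one_le_pow_sub_rad hN D hk i
    · have hr0 : rad hN D hk i = 0 := by omega
      rw [mc_caseB_eq_of_rad_eq_zero hN D hk i hA hr0]
      have hj := one_le_lvl_of_not_mem hN D hk i hA
      have h3 : 3 ≤ (ℓ + 1) ^ (lvl hN D hk i) := by
        have hl : 3 ≤ ℓ + 1 := by obtain ⟨r, hr'⟩ := hL.1; have := hL.2; omega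
        exact le_trans (by rw [pow_one]; exact hl) (Nat.pow_le_pow_right (by omega) hj)
      have h3' : (3 : ℝ) ≤ (((ℓ + 1) ^ (lvl hN D hk i) : ℕ) : ℝ) := by exact_mod_cast h3
      linarith

/-- `0 < mc`. [cite: Balaban1984PropagatorsII, (2.147) p.248, bookkeeping] -/
theorem mc_pos (i : BondIdx (domT hN D hk)) : 0 < mc hN D hk i := lt_of_lt_of_le one_pos (one_le_mc hN D hk i)

/-- `mc ≤ L^j`. [cite: Balaban1984PropagatorsII, (2.147) p.248, bookkeeping] -/
theorem mc_le_pow (i : BondIdx (domT hN D hk)) : mc hN D hk i ≤ (((ℓ + 1) ^ (lvl hN D hk i) : ℕ) : ℝ) := by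
  have hfit := ctr_fit' hN D hk i
  by_cases hA : i.1.2.src ∈ (domT hN D hk).Om (lvl hN D hk i)
  · rw [mc_caseA hN D hk i hA]
    have : ctr hN D hk i + 1 ≤ (ℓ + 1) ^ (lvl hN D hk i) := by have := hfit.2; unfold erad at this; omega
    exact_mod_cast this
  · rw [mc_caseB hN D hk i hA]
    have : (0 : ℝ) ≤ ctr hN D hk i := Nat.cast_nonneg _
    linarith

/-- **THE MASS IN CLOSED FORM FOR EVERY `L`**: `m_i = (Qφ_i)_i = c_Q·mc_i·Στ·(Στ_⊥)^d`. [cite: Balaban1984PropagatorsII, (2.147) p.248; Balaban1984PropagatorsI, (1.18) p.20] -/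
theorem mass_eq_coeff (i : BondIdx (domT hN D hk)) (hper : 2 ≤ (PV d ℓ m K hd hL).sitesPerDir (lvl hN D hk i)) :
    QE (domT hN D hk) (bump hN D hk i) i =
      cQ (d := d) (ℓ := ℓ) (lvl hN D hk i) * mc hN D hk i * tsumL hN D hk i * Tsum (ℓ := ℓ) (lvl hN D hk i) ^ d := by
  by_cases hA : i.1.2.src ∈ (domT hN D hk).Om (lvl hN D hk i)
  · rw [pair_src hN D hk i i hper rfl rfl (by rw [base_eq_src_of hN D hk i hA]), mc_caseA hN D hk i hA]
  · rw [pair_tgt hN D hk i i hper rfl rfl (by rw [base_eq_tgt_of hN D hk i hA]), mc_caseB hN D hk i hA]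

/-- `m_i > 0` for every odd `L ≥ 3`. [cite: Balaban1984PropagatorsII, (2.147) p.248, bookkeeping] -/
theorem mass_pos_all (i : BondIdx (domT hN D hk)) (hper : 2 ≤ (PV d ℓ m K hd hL).sitesPerDir (lvl hN D hk i)) :
    0 < QE (domT hN D hk) (bump hN D hk i) i := by
  rw [mass_eq_coeff hN D hk i hper]
  have h1 := tsumL_pos hN D hk i
  have h2 := Tsum_pos (ℓ := ℓ) (lvl hN D hk i)
  have h3 := cQ_pos (d := d) (ℓ := ℓ) (lvl hN D hk i)
  have h4 := mc_pos hN D hk i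
  positivity

/-- **`2·L^j ≤ 3·mc`** (`mc ∈ {L^j − r, L^j − 1, L^j}` with `5r ≤ L^j`, and `L^j ≥ 3` in case B) — so the leak coefficient `L^j − mc` is at most `½·mc`.
[cite: Balaban1984PropagatorsII, (2.147) p.248, bookkeeping] -/
theorem two_pow_le_three_mc (i : BondIdx (domT hN D hk)) : 2 * (((ℓ + 1) ^ (lvl hN D hk i) : ℕ) : ℝ) ≤ 3 * mc hN D hk i := by
  have h5 := five_mul_rad_le hN D hk i
  have h5' : 5 * (rad hN D hk i : ℝ) ≤ (((ℓ + 1) ^ (lvl hN D hk i) : ℕ) : ℝ) := by exact_mod_cast h5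
  by_cases hA : i.1.2.src ∈ (domT hN D hk).Om (lvl hN D hk i)
  · rw [mc_caseA_eq hN D hk i hA]; linarith
  · by_cases hr : 1 ≤ rad hN D hk i
    · rw [mc_caseB_eq hN D hk i hA hr]; linarith
    · have hr0 : rad hN D hk i = 0 := by omega
      rw [mc_caseB_eq_of_rad_eq_zero hN D hk i hA hr0]
      have hj := one_le_lvl_of_not_mem hN D hk i hA
      have h3 : 3 ≤ (ℓ + 1) ^ (lvl hN D hk i) := by
        have hl : 3 ≤ ℓ + 1 := by obtain ⟨r, hr'⟩ := hL.1; have := hL.2; omega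
        exact le_trans (by rw [pow_one]; exact hl) (Nat.pow_le_pow_right (by omega) hj)
      have h3' : (3 : ℝ) ≤ (((ℓ + 1) ^ (lvl hN D hk i) : ℕ) : ℝ) := by exact_mod_cast h3
      linarith

/-! ## §2  The same-level partner for every `L`: value `c_Q·(L^j − mc_i)·Στ·(Στ_⊥)^d`, size `≤ ½·m_i`, `≤ ¼·m_i` if `r ≥ 1`, `0` in case A with `r = 0` -/

/-- **THE SAME-LEVEL PARTNER PAIRING FOR EVERY `L`** (twin of `partner_eq` without `4 ≤ ℓ`): `(Qφ_i)_{i′} = c_Q·(L^j − mc_i)·Στ·(Στ_⊥)^d`.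
[cite: Balaban1984PropagatorsII, (2.147) p.248; Balaban1984PropagatorsI, (1.18) p.20] -/
theorem partner_eq_coeff (i i' : BondIdx (domT hN D hk)) (hper : 2 ≤ (PV d ℓ m K hd hL).sitesPerDir (lvl hN D hk i'))
    (hj : lvl hN D hk i' = lvl hN D hk i) (hdir : i'.1.2.dir = i.1.2.dir) (hne : i' ≠ i)
    (h : iterBlock (lvl hN D hk i') i'.1.2.src = iterBlock (lvl hN D hk i) (base hN D hk i) ∨
      iterBlock (lvl hN D hk i') i'.1.2.tgt = iterBlock (lvl hN D hk i) (base hN D hk i)) :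
    QE (domT hN D hk) (bump hN D hk i) i' =
      cQ (d := d) (ℓ := ℓ) (lvl hN D hk i) * ((((ℓ + 1) ^ (lvl hN D hk i) : ℕ) : ℝ) - mc hN D hk i) * tsumL hN D hk i * Tsum (ℓ := ℓ) (lvl hN D hk i) ^ d := by
  obtain ⟨⟨j₁, b₁⟩, hb₁⟩ := i'
  obtain ⟨⟨j₀, b₀⟩, hb₀⟩ := i
  have hjj : j₁ = j₀ := Fin.ext (by simpa [lvl] using hj)
  subst hjj
  simp only at hdir
  have hsrc_ne : b₁.src ≠ b₀.src := by
    intro hs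
    apply hne
    have : b₁ = b₀ := by cases b₁; cases b₀; simp only at hs hdir; simp [hs, hdir]
    subst this; rfl
  rcases h with h | h
  · -- source-type: then case B for `i`
    rw [pair_src hN D hk _ _ hper hj hdir h]
    by_cases hA : b₀.src ∈ (domT hN D hk).Om (lvl hN D hk ⟨⟨j₁, b₀⟩, hb₀⟩)
    · exfalso
      rw [base_eq_src_of hN D hk _ hA] at h
      exact hsrc_ne (iterBlock_injective (lvl_le_mK hN D hk ⟨⟨j₁, b₀⟩, hb₀⟩) h)
    · rw [mc_caseB hN D hk _ hA]; ring
  · -- target-type: then case A for `i`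
    rw [pair_tgt hN D hk _ _ hper hj hdir h]
    by_cases hA : b₀.src ∈ (domT hN D hk).Om (lvl hN D hk ⟨⟨j₁, b₀⟩, hb₀⟩)
    · rw [mc_caseA hN D hk _ hA]; ring
    · exfalso
      rw [base_eq_tgt_of hN D hk _ hA] at h
      have htgt : b₁.tgt = b₀.tgt := iterBlock_injective (lvl_le_mK hN D hk ⟨⟨j₁, b₀⟩, hb₀⟩) h
      unfold PBond.tgt at htgt
      rw [hdir] at htgt
      exact hsrc_ne (shift_injective b₀.dir htgt)

/-- the leak coefficient `L^j − mc` is at most half the mass coefficient (from `2·L^j ≤ 3·mc`). [cite: Balaban1984PropagatorsII, (2.147) p.248, bookkeeping] -/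
theorem pow_sub_mc_le_half (i : BondIdx (domT hN D hk)) :
    (((ℓ + 1) ^ (lvl hN D hk i) : ℕ) : ℝ) - mc hN D hk i ≤ (1 / 2) * mc hN D hk i := by
  have := two_pow_le_three_mc hN D hk i; linarith

/-- with `1 ≤ r` the leak coefficient is `r ≤ ¼·(L^j − r) = ¼·mc`. [cite: Balaban1984PropagatorsII, (2.147) p.248, bookkeeping] -/
theorem pow_sub_mc_le_quarter (i : BondIdx (domT hN D hk)) (hr : 1 ≤ rad hN D hk i) :
    (((ℓ + 1) ^ (lvl hN D hk i) : ℕ) : ℝ) - mc hN D hk i ≤ (1 / 4) * mc hN D hk i := by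
  have h5 := five_mul_rad_le hN D hk i
  have h5' : 5 * (rad hN D hk i : ℝ) ≤ (((ℓ + 1) ^ (lvl hN D hk i) : ℕ) : ℝ) := by exact_mod_cast h5
  by_cases hA : i.1.2.src ∈ (domT hN D hk).Om (lvl hN D hk i)
  · rw [mc_caseA_eq hN D hk i hA]; linarith
  · rw [mc_caseB_eq hN D hk i hA hr]; linarith

/-- in case A with `r = 0` the leak coefficient VANISHES (the spike sits on the last slice, which the predecessor row does not see).
[cite: Balaban1984PropagatorsII, (2.147) p.248, bookkeeping] -/
theorem pow_sub_mc_eq_zero (i : BondIdx (domT hN D hk)) (hA : i.1.2.src ∈ (domT hN D hk).Om (lvl hN D hk i)) (hr : rad hN D hk i = 0) :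
    (((ℓ + 1) ^ (lvl hN D hk i) : ℕ) : ℝ) - mc hN D hk i = 0 := by
  rw [mc_caseA_eq hN D hk i hA, hr]; push_cast; ring

/-- **THE PARTNER IS NON-NEGATIVE AND AT MOST HALF THE MASS, FOR EVERY ODD `L ≥ 3`** (twin of `partner_le` without `4 ≤ ℓ`).
[cite: Balaban1984PropagatorsII, (2.147) p.248, bookkeeping] -/
theorem partner_le_half (i i' : BondIdx (domT hN D hk)) (hper' : 2 ≤ (PV d ℓ m K hd hL).sitesPerDir (lvl hN D hk i'))
    (hper : 2 ≤ (PV d ℓ m K hd hL).sitesPerDir (lvl hN D hk i))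
    (hj : lvl hN D hk i' = lvl hN D hk i) (hdir : i'.1.2.dir = i.1.2.dir) (hne : i' ≠ i)
    (h : iterBlock (lvl hN D hk i') i'.1.2.src = iterBlock (lvl hN D hk i) (base hN D hk i) ∨
      iterBlock (lvl hN D hk i') i'.1.2.tgt = iterBlock (lvl hN D hk i) (base hN D hk i)) :
    0 ≤ QE (domT hN D hk) (bump hN D hk i) i' ∧ QE (domT hN D hk) (bump hN D hk i) i' ≤ (1 / 2) * QE (domT hN D hk) (bump hN D hk i) i := by
  rw [partner_eq_coeff hN D hk i i' hper' hj hdir hne h, mass_eq_coeff hN D hk i hper]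
  have hc := cQ_pos (d := d) (ℓ := ℓ) (lvl hN D hk i)
  have ht : 0 < tsumL hN D hk i * Tsum (ℓ := ℓ) (lvl hN D hk i) ^ d :=
    mul_pos (tsumL_pos hN D hk i) (pow_pos (Tsum_pos (ℓ := ℓ) _) _)
  have hl0 : (0 : ℝ) ≤ (((ℓ + 1) ^ (lvl hN D hk i) : ℕ) : ℝ) - mc hN D hk i := sub_nonneg.2 (mc_le_pow hN D hk i)
  have hle := pow_sub_mc_le_half hN D hk i
  constructor
  · have := mul_nonneg (mul_nonneg hc.le hl0) ht.le
    calc (0 : ℝ) ≤ cQ (d := d) (ℓ := ℓ) (lvl hN D hk i) * ((((ℓ + 1) ^ (lvl hN D hk i) : ℕ) : ℝ) - mc hN D hk i) *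
        (tsumL hN D hk i * Tsum (ℓ := ℓ) (lvl hN D hk i) ^ d) := this
      _ = _ := by ring
  · have key := mul_le_mul_of_nonneg_right (mul_le_mul_of_nonneg_left hle hc.le) ht.le
    calc cQ (d := d) (ℓ := ℓ) (lvl hN D hk i) * ((((ℓ + 1) ^ (lvl hN D hk i) : ℕ) : ℝ) - mc hN D hk i) * tsumL hN D hk i * Tsum (ℓ := ℓ) (lvl hN D hk i) ^ d
        = cQ (d := d) (ℓ := ℓ) (lvl hN D hk i) * ((((ℓ + 1) ^ (lvl hN D hk i) : ℕ) : ℝ) - mc hN D hk i) * (tsumL hN D hk i * Tsum (ℓ := ℓ) (lvl hN D hk i) ^ d) := by ring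
      _ ≤ cQ (d := d) (ℓ := ℓ) (lvl hN D hk i) * ((1 / 2) * mc hN D hk i) * (tsumL hN D hk i * Tsum (ℓ := ℓ) (lvl hN D hk i) ^ d) := key
      _ = _ := by ring

/-- **… AND AT MOST A QUARTER OF THE MASS WHEN `1 ≤ r`** (every level with `L^j ≥ 5`; = the lineage's `partner_le`).
[cite: Balaban1984PropagatorsII, (2.147) p.248, bookkeeping] -/
theorem partner_le_quarter (i i' : BondIdx (domT hN D hk)) (hr : 1 ≤ rad hN D hk i) (hper' : 2 ≤ (PV d ℓ m K hd hL).sitesPerDir (lvl hN D hk i'))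
    (hper : 2 ≤ (PV d ℓ m K hd hL).sitesPerDir (lvl hN D hk i))
    (hj : lvl hN D hk i' = lvl hN D hk i) (hdir : i'.1.2.dir = i.1.2.dir) (hne : i' ≠ i)
    (h : iterBlock (lvl hN D hk i') i'.1.2.src = iterBlock (lvl hN D hk i) (base hN D hk i) ∨
      iterBlock (lvl hN D hk i') i'.1.2.tgt = iterBlock (lvl hN D hk i) (base hN D hk i)) :
    QE (domT hN D hk) (bump hN D hk i) i' ≤ (1 / 4) * QE (domT hN D hk) (bump hN D hk i) i := by
  rw [partner_eq_coeff hN D hk i i' hper' hj hdir hne h, mass_eq_coeff hN D hk i hper]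
  have hc := cQ_pos (d := d) (ℓ := ℓ) (lvl hN D hk i)
  have ht : 0 < tsumL hN D hk i * Tsum (ℓ := ℓ) (lvl hN D hk i) ^ d :=
    mul_pos (tsumL_pos hN D hk i) (pow_pos (Tsum_pos (ℓ := ℓ) _) _)
  have hle := pow_sub_mc_le_quarter hN D hk i hr
  have key := mul_le_mul_of_nonneg_right (mul_le_mul_of_nonneg_left hle hc.le) ht.le
  calc cQ (d := d) (ℓ := ℓ) (lvl hN D hk i) * ((((ℓ + 1) ^ (lvl hN D hk i) : ℕ) : ℝ) - mc hN D hk i) * tsumL hN D hk i * Tsum (ℓ := ℓ) (lvl hN D hk i) ^ d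
      = cQ (d := d) (ℓ := ℓ) (lvl hN D hk i) * ((((ℓ + 1) ^ (lvl hN D hk i) : ℕ) : ℝ) - mc hN D hk i) * (tsumL hN D hk i * Tsum (ℓ := ℓ) (lvl hN D hk i) ^ d) := by ring
    _ ≤ cQ (d := d) (ℓ := ℓ) (lvl hN D hk i) * ((1 / 4) * mc hN D hk i) * (tsumL hN D hk i * Tsum (ℓ := ℓ) (lvl hN D hk i) ^ d) := key
    _ = _ := by ring

/-- **… AND ZERO IN CASE A WHEN `r = 0`** (`L = 3`, `j = 1`: no same-level leak from an interior/exiting bond).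
[cite: Balaban1984PropagatorsII, (2.147) p.248, bookkeeping] -/
theorem partner_eq_zero_of_caseA (i i' : BondIdx (domT hN D hk)) (hA : i.1.2.src ∈ (domT hN D hk).Om (lvl hN D hk i)) (hr : rad hN D hk i = 0)
    (hper' : 2 ≤ (PV d ℓ m K hd hL).sitesPerDir (lvl hN D hk i'))
    (hj : lvl hN D hk i' = lvl hN D hk i) (hdir : i'.1.2.dir = i.1.2.dir) (hne : i' ≠ i)
    (h : iterBlock (lvl hN D hk i') i'.1.2.src = iterBlock (lvl hN D hk i) (base hN D hk i) ∨
      iterBlock (lvl hN D hk i') i'.1.2.tgt = iterBlock (lvl hN D hk i) (base hN D hk i)) :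
    QE (domT hN D hk) (bump hN D hk i) i' = 0 := by
  rw [partner_eq_coeff hN D hk i i' hper' hj hdir hne h, pow_sub_mc_eq_zero hN D hk i hA hr]; ring

/-! ## §3  When `r = 0` a row receives at most ONE same-level leak (from its case-B predecessor) -/

/-- two same-level, same-direction index bonds with the same TARGET block are equal. [cite: Balaban1984PropagatorsII, (2.3)/(2.20) p.224–226, bookkeeping] -/
theorem eq_of_tgt_block_eq {i i' : BondIdx (domT hN D hk)} (hj : lvl hN D hk i = lvl hN D hk i') (hdir : i.1.2.dir = i'.1.2.dir)
    (hblk : iterBlock (lvl hN D hk i) i.1.2.tgt = iterBlock (lvl hN D hk i') i'.1.2.tgt) : i = i' := by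
  obtain ⟨⟨j₀, b₀⟩, hb₀⟩ := i
  obtain ⟨⟨j₁, b₁⟩, hb₁⟩ := i'
  have hjj : j₀ = j₁ := Fin.ext (by simpa [lvl] using hj)
  subst hjj
  simp only at hdir
  have htgt : b₀.tgt = b₁.tgt := iterBlock_injective (lvl_le_mK hN D hk ⟨⟨j₀, b₀⟩, hb₀⟩) hblk
  unfold PBond.tgt at htgt
  rw [hdir] at htgt
  have hsrc : b₀.src = b₁.src := shift_injective b₁.dir htgt
  have hb : b₀ = b₁ := by cases b₀; cases b₁; simp only at hsrc hdir; simp [hsrc, hdir]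
  subst hb; rfl

/-- **A NONZERO SAME-LEVEL LEAK FROM A BOND WITH `r = 0` COMES FROM CASE B INTO ITS SUCCESSOR**: `i` is case B and the source block of `i′` is the
target (= base) block of `i`. [cite: Balaban1984PropagatorsII, (2.147) p.248, (2.3) p.224, bookkeeping] -/
theorem leak_structure_of_rad_eq_zero (i i' : BondIdx (domT hN D hk)) (hr : rad hN D hk i = 0)
    (hper' : 2 ≤ (PV d ℓ m K hd hL).sitesPerDir (lvl hN D hk i')) (hj : lvl hN D hk i' = lvl hN D hk i) (hne : i' ≠ i)
    (h : QE (domT hN D hk) (bump hN D hk i) i' ≠ 0) :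
    i.1.2.src ∉ (domT hN D hk).Om (lvl hN D hk i) ∧ iterBlock (lvl hN D hk i') i'.1.2.src = iterBlock (lvl hN D hk i) i.1.2.tgt := by
  have hdir : i'.1.2.dir = i.1.2.dir := (witness_of_pair_ne_zero hN D hk i i' h).1
  have hblk := same_level_block hN D hk i i' hj h
  have hB : i.1.2.src ∉ (domT hN D hk).Om (lvl hN D hk i) := by
    intro hA
    exact h (partner_eq_zero_of_caseA hN D hk i i' hA hr hper' hj hdir hne hblk)
  refine ⟨hB, ?_⟩
  rw [base_eq_tgt_of hN D hk i hB] at hblk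
  rcases hblk with hs | ht
  · exact hs
  · exact absurd (eq_of_tgt_block_eq hN D hk hj hdir ht) hne

/-- hence **AT MOST ONE BOND WITH `r = 0` LEAKS INTO A GIVEN ROW** (its case-B predecessor). [cite: Balaban1984PropagatorsII, (2.147) p.248, bookkeeping] -/
theorem card_rad_zero_leakers_le_one (i' : BondIdx (domT hN D hk)) (hper' : 2 ≤ (PV d ℓ m K hd hL).sitesPerDir (lvl hN D hk i')) :
    (Finset.univ.filter fun i : BondIdx (domT hN D hk) =>
        lvl hN D hk i = lvl hN D hk i' ∧ i ≠ i' ∧ rad hN D hk i = 0 ∧ QE (domT hN D hk) (bump hN D hk i) i' ≠ 0).card ≤ 1 := by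
  classical
  refine Finset.card_le_one.2 fun i₁ h₁ i₂ h₂ => ?_
  rw [Finset.mem_filter] at h₁ h₂
  obtain ⟨-, hj₁, hne₁, hr₁, hc₁⟩ := h₁
  obtain ⟨-, hj₂, hne₂, hr₂, hc₂⟩ := h₂
  have hs₁ := (leak_structure_of_rad_eq_zero hN D hk i₁ i' hr₁ hper' hj₁.symm hne₁.symm hc₁).2
  have hs₂ := (leak_structure_of_rad_eq_zero hN D hk i₂ i' hr₂ hper' hj₂.symm hne₂.symm hc₂).2
  have hd₁ : i'.1.2.dir = i₁.1.2.dir := (witness_of_pair_ne_zero hN D hk i₁ i' hc₁).1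
  have hd₂ : i'.1.2.dir = i₂.1.2.dir := (witness_of_pair_ne_zero hN D hk i₂ i' hc₂).1
  exact eq_of_tgt_block_eq hN D hk (hj₁.trans hj₂.symm) (hd₁.symm.trans hd₂) (hs₁.symm.trans hs₂)


/-! ## §4  The coarse rows (level `j + 1`) of a fine bump, for every odd `L ≥ 3`: only case-A bumps are seen ((2.2) with `R·M̂ ≥ 3`), the two exact
pairings `c_Q^{(j+1)}·(L^j·u + ctr + 1)·Στ·(Στ_⊥)^d` / `c_Q^{(j+1)}·(L^{j+1} − 1 − L^j·u − ctr)·Στ·(Στ_⊥)^d`, the two-row sum `≤ c_Q^{(j+1)}·L^{j+1}·Στ·(Στ_⊥)^d`,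
and the count `≤ L^D` of fine bumps seen by one coarse row -/

section Coarse

open B5Eq118OneStroke (iterBlockOf mem_iterBlock card_iterBlock)
open B6MultiLevelBoxOperator (bigSide)
open B6GlobalChartV1 (toBox)
open B6GlobalChartV1L0 (iterBlockOf_mem_domT_iff)
open B6MemberOfCubeV1 (torusSupNorm_sub_le one_le_N0)
open B6Geom246MultiLevelTorus (torusSupNorm_neg)
open B6AgreeQaQV1Chart (iterBlock_nonempty)
open B6Ineq2142KLevelV1 (iterBlockOf_eq_of_le)
open B6Ineq2142KLevelV1L0 (lvl_le other ends_eq baseSite iterBlockOf_baseSite lev_eq_of_base near_base qwt)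
open Literature.MathematicalPhysics.QuantumFieldTheory.Balaban1983to89.B6QGQTestBumpsKLevelV1 (loc loc_lt val_eq_of_mem sum_affine_tent tgt_eq_iff_src_eq)
open Literature.MathematicalPhysics.QuantumFieldTheory.Balaban1983to89.B6QGQTestBumpsKLevelV1L0 (qwt_src qwt_tgt pair_eq_of_weight baseBlk_subset_other
  pair_nonneg srcBlk ext_of_key card_key_le_one tauL_nonneg one_le_erad)

/-- **A FINE BUMP SEEN BY A COARSE ROW IS A CASE-A BUMP** (`R·M̂ ≥ 3`): in case B the source block of `i` consists of sites of level `< j`, within torus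
distance `< 2L^{j+1} + 2L^j ≤ 3L^{j+1} ≤ R·M̂·L^{j+1}` of the level-`(j+1)` base site of `i′` — against (2.2) (`TDomains.sepT j`).
[cite: Balaban1984PropagatorsII, (2.2) p.224, (2.147) p.248] -/
theorem caseA_of_coarse_pair_ne_zero (hRM : 3 ≤ R * Mh) (i i' : BondIdx (domT hN D hk)) (hj : lvl hN D hk i' = lvl hN D hk i + 1)
    (h : QE (domT hN D hk) (bump hN D hk i) i' ≠ 0) : i.1.2.src ∈ (domT hN D hk).Om (lvl hN D hk i) := by
  by_contra hB
  -- a fine site of the source block of `i`; it has level `< j`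
  obtain ⟨x₁, hx₁⟩ := iterBlock_nonempty (lvl_le_mK hN D hk i) i.1.2.src
  rw [mem_iterBlock] at hx₁
  have hlev₁ : D.lev (toBox hN x₁ : Fin (d + 1) → ℤ) < lvl hN D hk i := by
    by_contra hge
    have hmem := (iterBlockOf_mem_domT_iff hN D hk (lvl_le hN D hk i) x₁).2 (not_lt.1 hge)
    rw [hx₁] at hmem
    exact hB hmem
  -- the base site of `i′` has level `j + 1`
  have hlev' : D.lev (toBox hN (baseSite hN D hk i') : Fin (d + 1) → ℤ) = lvl hN D hk i' :=
    lev_eq_of_base hN D hk i' (iterBlockOf_baseSite hN D hk i')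
  -- the base site of `i` lies in the non-base end block of `i′`
  have hb : baseSite hN D hk i ∈ iterBlock (lvl hN D hk i') (other hN D hk i') :=
    baseBlk_subset_other hN D hk i i' hj h (by rw [mem_iterBlock]; exact iterBlockOf_baseSite hN D hk i)
  rw [mem_iterBlock] at hb
  have hends' : iterBlockOf (lvl hN D hk i') (baseSite hN D hk i) = i'.1.2.src ∨ iterBlockOf (lvl hN D hk i') (baseSite hN D hk i) = i'.1.2.tgt := by
    rcases ends_eq hN D hk i' with ⟨-, ho⟩ | ⟨-, ho⟩
    · right; rw [hb, ho]
    · left; rw [hb, ho]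
  have hd1 := near_base hN D hk i' hends'
  have hd2 := near_base hN D hk i (Or.inl hx₁)
  have htri := torusSupNorm_sub_le (one_le_N0 hN) (toBox hN (baseSite hN D hk i')).1 (toBox hN (baseSite hN D hk i)).1 (toBox hN x₁).1
  -- (2.2) at level `j`
  have hsep := D.sepT (lvl hN D hk i) (toBox hN x₁).1 (toBox hN x₁).2 (toBox hN (baseSite hN D hk i')).1 (toBox hN (baseSite hN D hk i')).2
    hlev₁ (by rw [hlev', hj])
  rw [show (toBox hN x₁).1 - (toBox hN (baseSite hN D hk i')).1 = -((toBox hN (baseSite hN D hk i')).1 - (toBox hN x₁).1) by abel,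
    torusSupNorm_neg (one_le_N0 hN)] at hsep
  -- `R·M̂·L^{j+1} ≥ 3L^{j+1} ≥ 2L^{j+1} + 2L^j`
  have hbig : 2 * (((ℓ + 1 : ℕ) : ℝ)) ^ (lvl hN D hk i') + 2 * (((ℓ + 1 : ℕ) : ℝ)) ^ (lvl hN D hk i) ≤
      ((R * bigSide ℓ Mh (lvl hN D hk i) : ℕ) : ℝ) := by
    unfold bigSide
    rw [hj, pow_succ]
    have h3 : (3 : ℝ) ≤ ((R * Mh : ℕ) : ℝ) := by exact_mod_cast hRM
    have hL2 : (2 : ℝ) ≤ ((ℓ + 1 : ℕ) : ℝ) := by exact_mod_cast hL.2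
    have hpos : (0 : ℝ) ≤ (((ℓ + 1 : ℕ) : ℝ)) ^ (lvl hN D hk i) := by positivity
    have e : ((R * (Mh * (ℓ + 1) ^ (lvl hN D hk i + 1)) : ℕ) : ℝ) =
        ((R * Mh : ℕ) : ℝ) * ((((ℓ + 1 : ℕ) : ℝ)) ^ (lvl hN D hk i) * ((ℓ + 1 : ℕ) : ℝ)) := by push_cast; ring
    rw [e]
    have hL0 : (0 : ℝ) ≤ ((ℓ + 1 : ℕ) : ℝ) := by positivity
    nlinarith [mul_nonneg (sub_nonneg.2 h3) (mul_nonneg hpos hL0), mul_nonneg hpos (sub_nonneg.2 hL2)]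
  linarith

/-- the longitudinal position `u ∈ [0, L)` of the `j`-block `base i` inside its `(j+1)`-block. [cite: Balaban1984PropagatorsI, (1.6) p.18, (1.16) p.20, dictionary] -/
def upos (i : BondIdx (domT hN D hk)) : ℕ := ((base hN D hk i) i.1.2.dir).val % (ℓ + 1)

/-- `u < L`. [cite: Balaban1984PropagatorsI, (1.6) p.18, bookkeeping] -/
theorem upos_lt (i : BondIdx (domT hN D hk)) : upos hN D hk i < ℓ + 1 := Nat.mod_lt _ (Nat.succ_pos ℓ)

/-- **BLOCK-LOCAL COORDINATES ONE LEVEL UP**: `loc_{j+1}(z) = L^j·u + loc_j(z)` on `B^j(base i)`. [cite: Balaban1984PropagatorsI, (1.6) p.18, (1.16) p.20, dictionary] -/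
theorem loc_succ_eq (i : BondIdx (domT hN D hk)) {z : Site (PV d ℓ m K hd hL) 0} (hz : z ∈ iterBlock (lvl hN D hk i) (base hN D hk i)) :
    loc (lvl hN D hk i + 1) z i.1.2.dir = (ℓ + 1) ^ (lvl hN D hk i) * upos hN D hk i + loc (lvl hN D hk i) z i.1.2.dir := by
  have hv := val_eq_of_mem (lvl_le_mK hN D hk i) hz i.1.2.dir
  have hr := loc_lt (lvl hN D hk i) z i.1.2.dir
  have hu : upos hN D hk i < ℓ + 1 := upos_lt hN D hk i
  set S := (ℓ + 1) ^ (lvl hN D hk i) with hSdef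
  set y := ((base hN D hk i) i.1.2.dir).val with hydef
  set r := loc (lvl hN D hk i) z i.1.2.dir with hrdef
  have hy : y = (ℓ + 1) * (y / (ℓ + 1)) + upos hN D hk i := (Nat.div_add_mod y (ℓ + 1)).symm
  show (z i.1.2.dir).val % (ℓ + 1) ^ (lvl hN D hk i + 1) = S * upos hN D hk i + r
  rw [pow_succ, ← hSdef, hv]
  have e : y * S + r = (S * (ℓ + 1)) * (y / (ℓ + 1)) + (S * upos hN D hk i + r) := by
    conv_lhs => rw [hy]
    ring
  rw [e, Nat.mul_add_mod, Nat.mod_eq_of_lt]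
  calc S * upos hN D hk i + r < S * upos hN D hk i + S := by omega
    _ = S * (upos hN D hk i + 1) := by ring
    _ ≤ S * (ℓ + 1) := Nat.mul_le_mul_left _ hu

/-- `L^j·u + loc_j + 1 ≤ L^{j+1}` on the base block. [cite: Balaban1984PropagatorsI, (1.6) p.18, bookkeeping] -/
theorem pow_mul_upos_add_lt (i : BondIdx (domT hN D hk)) (t : ℕ) (ht : t < (ℓ + 1) ^ (lvl hN D hk i)) :
    (ℓ + 1) ^ (lvl hN D hk i) * upos hN D hk i + t + 1 ≤ (ℓ + 1) ^ (lvl hN D hk i + 1) := by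
  have hu : upos hN D hk i + 1 ≤ ℓ + 1 := upos_lt hN D hk i
  calc (ℓ + 1) ^ (lvl hN D hk i) * upos hN D hk i + t + 1 ≤ (ℓ + 1) ^ (lvl hN D hk i) * upos hN D hk i + (ℓ + 1) ^ (lvl hN D hk i) := by omega
    _ = (ℓ + 1) ^ (lvl hN D hk i) * (upos hN D hk i + 1) := by ring
    _ ≤ (ℓ + 1) ^ (lvl hN D hk i) * (ℓ + 1) := Nat.mul_le_mul_left _ hu
    _ = (ℓ + 1) ^ (lvl hN D hk i + 1) := (pow_succ _ _).symm

/-- **THE SOURCE-TYPE COARSE PAIRING**: if `B^j(base i) ⊆ B^{j+1}(src i′)` (`j(i′) = j(i) + 1`, same direction) then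
`(Qφ_i)_{i′} = c_Q^{(j+1)}·(L^j·u + ctr + 1)·Στ·(Στ_⊥)^d`. [cite: Balaban1984PropagatorsII, (2.147) p.248; Balaban1984PropagatorsI, (1.16)–(1.18) p.20] -/
theorem coarse_pair_src (i i' : BondIdx (domT hN D hk)) (hper : 2 ≤ (PV d ℓ m K hd hL).sitesPerDir (lvl hN D hk i'))
    (hj : lvl hN D hk i' = lvl hN D hk i + 1) (hdir : i'.1.2.dir = i.1.2.dir)
    (hsub : iterBlock (lvl hN D hk i) (base hN D hk i) ⊆ iterBlock (lvl hN D hk i') i'.1.2.src) :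
    QE (domT hN D hk) (bump hN D hk i) i' =
      cQ (d := d) (ℓ := ℓ) (lvl hN D hk i + 1) * ((((ℓ + 1) ^ (lvl hN D hk i) : ℕ) : ℝ) * upos hN D hk i + ctr hN D hk i + 1) *
        tsumL hN D hk i * Tsum (ℓ := ℓ) (lvl hN D hk i) ^ d := by
  have hq : ∀ z ∈ iterBlock (lvl hN D hk i) (base hN D hk i), qwt hN D hk i' ⟨z, i.1.2.dir⟩ =
      cQ (d := d) (ℓ := ℓ) (lvl hN D hk i + 1) *
        (fun u : ℕ => ((((ℓ + 1) ^ (lvl hN D hk i) : ℕ) : ℝ) * upos hN D hk i + 1) + (1 : ℝ) * u) (loc (lvl hN D hk i) z i.1.2.dir) := by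
    intro z hz
    have h := qwt_src hN D hk i' hper (hsub hz)
    rw [hdir, hj] at h
    rw [h, loc_succ_eq hN D hk i hz]
    push_cast; ring
  rw [pair_eq_of_weight hN D hk i i' (c := cQ (d := d) (ℓ := ℓ) (lvl hN D hk i + 1))
    (a := fun u : ℕ => ((((ℓ + 1) ^ (lvl hN D hk i) : ℕ) : ℝ) * upos hN D hk i + 1) + (1 : ℝ) * u) hq]
  have hfit := ctr_fit' hN D hk i
  have haff := sum_affine_tent (S := (ℓ + 1) ^ (lvl hN D hk i)) hfit.1 hfit.2 ((((ℓ + 1) ^ (lvl hN D hk i) : ℕ) : ℝ) * upos hN D hk i + 1) 1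
  unfold tsumL tauL
  rw [haff]; ring

/-- **THE TARGET-TYPE COARSE PAIRING**: if `B^j(base i) ⊆ B^{j+1}(tgt i′)` (`j(i′) = j(i) + 1`, same direction) then
`(Qφ_i)_{i′} = c_Q^{(j+1)}·(L^{j+1} − 1 − L^j·u − ctr)·Στ·(Στ_⊥)^d`. [cite: Balaban1984PropagatorsII, (2.147) p.248; Balaban1984PropagatorsI, (1.16)–(1.18) p.20] -/
theorem coarse_pair_tgt (i i' : BondIdx (domT hN D hk)) (hper : 2 ≤ (PV d ℓ m K hd hL).sitesPerDir (lvl hN D hk i'))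
    (hj : lvl hN D hk i' = lvl hN D hk i + 1) (hdir : i'.1.2.dir = i.1.2.dir)
    (hsub : iterBlock (lvl hN D hk i) (base hN D hk i) ⊆ iterBlock (lvl hN D hk i') i'.1.2.tgt) :
    QE (domT hN D hk) (bump hN D hk i) i' =
      cQ (d := d) (ℓ := ℓ) (lvl hN D hk i + 1) *
        ((((ℓ + 1) ^ (lvl hN D hk i + 1) : ℕ) : ℝ) - 1 - (((ℓ + 1) ^ (lvl hN D hk i) : ℕ) : ℝ) * upos hN D hk i - ctr hN D hk i) *
        tsumL hN D hk i * Tsum (ℓ := ℓ) (lvl hN D hk i) ^ d := by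
  have hq : ∀ z ∈ iterBlock (lvl hN D hk i) (base hN D hk i), qwt hN D hk i' ⟨z, i.1.2.dir⟩ =
      cQ (d := d) (ℓ := ℓ) (lvl hN D hk i + 1) *
        (fun u : ℕ => ((((ℓ + 1) ^ (lvl hN D hk i + 1) : ℕ) : ℝ) - 1 - (((ℓ + 1) ^ (lvl hN D hk i) : ℕ) : ℝ) * upos hN D hk i) + (-1 : ℝ) * u)
          (loc (lvl hN D hk i) z i.1.2.dir) := by
    intro z hz
    have h := qwt_tgt hN D hk i' hper (hsub hz)
    rw [hdir, hj] at h
    rw [h, loc_succ_eq hN D hk i hz]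
    have hle := pow_mul_upos_add_lt hN D hk i _ (loc_lt (lvl hN D hk i) z i.1.2.dir)
    simp only
    rw [Nat.cast_sub (by omega), Nat.cast_sub (Nat.one_le_pow _ _ (by omega))]
    push_cast; ring
  rw [pair_eq_of_weight hN D hk i i' (c := cQ (d := d) (ℓ := ℓ) (lvl hN D hk i + 1))
    (a := fun u : ℕ => ((((ℓ + 1) ^ (lvl hN D hk i + 1) : ℕ) : ℝ) - 1 - (((ℓ + 1) ^ (lvl hN D hk i) : ℕ) : ℝ) * upos hN D hk i) + (-1 : ℝ) * u) hq]
  have hfit := ctr_fit' hN D hk i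
  have haff := sum_affine_tent (S := (ℓ + 1) ^ (lvl hN D hk i)) hfit.1 hfit.2
    ((((ℓ + 1) ^ (lvl hN D hk i + 1) : ℕ) : ℝ) - 1 - (((ℓ + 1) ^ (lvl hN D hk i) : ℕ) : ℝ) * upos hN D hk i) (-1)
  unfold tsumL tauL
  rw [haff]; ring

/-- **A COARSE ROW SEEING `φ_i` HAS THE DIRECTION OF `i` AND CONTAINS `B^j(base i)` IN ITS SOURCE BLOCK OR IN ITS TARGET BLOCK.**
[cite: Balaban1984PropagatorsII, (2.1)–(2.3) p.224, (2.147) p.248, bookkeeping] -/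
theorem coarse_cases (i i' : BondIdx (domT hN D hk)) (hj : lvl hN D hk i' = lvl hN D hk i + 1) (h : QE (domT hN D hk) (bump hN D hk i) i' ≠ 0) :
    i'.1.2.dir = i.1.2.dir ∧ (iterBlock (lvl hN D hk i) (base hN D hk i) ⊆ iterBlock (lvl hN D hk i') i'.1.2.src ∨
      iterBlock (lvl hN D hk i) (base hN D hk i) ⊆ iterBlock (lvl hN D hk i') i'.1.2.tgt) := by
  refine ⟨(witness_of_pair_ne_zero hN D hk i i' h).1, ?_⟩
  have hsub := baseBlk_subset_other hN D hk i i' hj h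
  rcases ends_eq hN D hk i' with ⟨-, ho⟩ | ⟨-, ho⟩
  · right; rwa [ho] at hsub
  · left; rwa [ho] at hsub

/-- **THE TWO COARSE ROWS OF A FINE BUMP TOGETHER CARRY AT MOST `c_Q^{(j+1)}·L^{j+1}·Στ·(Στ_⊥)^d`** (there is at most one source-type and at most one
target-type row of level `j + 1` over `B^j(base i)`, and their affine weights add up to the constant `c_Q^{(j+1)}·L^{j+1}`).
[cite: Balaban1984PropagatorsII, (2.147) p.248; Balaban1984PropagatorsI, (1.16)–(1.18) p.20, bookkeeping] -/
theorem coarse_sum_le (hper : ∀ n, n ≤ k + 1 → 2 ≤ (PV d ℓ m K hd hL).sitesPerDir n) (i : BondIdx (domT hN D hk)) :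
    ∑ i' ∈ Finset.univ.filter (fun i' : BondIdx (domT hN D hk) => lvl hN D hk i' = lvl hN D hk i + 1), QE (domT hN D hk) (bump hN D hk i) i' ≤
      cQ (d := d) (ℓ := ℓ) (lvl hN D hk i + 1) * (((ℓ + 1) ^ (lvl hN D hk i + 1) : ℕ) : ℝ) * tsumL hN D hk i * Tsum (ℓ := ℓ) (lvl hN D hk i) ^ d := by
  classical
  set j := lvl hN D hk i with hjdef
  set μ := i.1.2.dir with hμ
  set x₀ := baseSite hN D hk i with hx₀def
  set M := tsumL hN D hk i * Tsum (ℓ := ℓ) j ^ d with hMdef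
  set S : ℝ := (((ℓ + 1) ^ j : ℕ) : ℝ) with hSdef
  set S' : ℝ := (((ℓ + 1) ^ (j + 1) : ℕ) : ℝ) with hS'def
  set F := Finset.univ.filter (fun i' : BondIdx (domT hN D hk) => lvl hN D hk i' = j + 1) with hF
  set F1 := Finset.univ.filter (fun i' : BondIdx (domT hN D hk) => lvl hN D hk i' = j + 1 ∧ i'.1.2.dir = μ ∧
    srcBlk hN D hk i' = iterBlock (j + 1) (iterBlockOf (j + 1) x₀)) with hF1
  set F2 := Finset.univ.filter (fun i' : BondIdx (domT hN D hk) => lvl hN D hk i' = j + 1 ∧ i'.1.2.dir = μ ∧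
    iterBlock (lvl hN D hk i') i'.1.2.tgt = iterBlock (j + 1) (iterBlockOf (j + 1) x₀)) with hF2
  have hx₀ : x₀ ∈ iterBlock j (base hN D hk i) := by rw [mem_iterBlock]; exact iterBlockOf_baseSite hN D hk i
  have hM0 : 0 ≤ M := mul_nonneg (Finset.sum_nonneg fun t _ => tauL_nonneg hN D hk i t) (pow_nonneg (Tsum_pos (ℓ := ℓ) j).le _)
  have hc := cQ_pos (d := d) (ℓ := ℓ) (j + 1)
  have hper' : 2 ≤ (PV d ℓ m K hd hL).sitesPerDir (j + 1) := hper (j + 1) (by have := lvl_le hN D hk i; omega)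
  -- step 1: the nonzero rows lie in `F1 ∪ F2`
  have hmem : ∀ i' ∈ F, QE (domT hN D hk) (bump hN D hk i) i' ≠ 0 → i' ∈ F1 ∪ F2 := by
    intro i' hi' hne
    rw [hF, Finset.mem_filter] at hi'
    obtain ⟨hdir, hcases⟩ := coarse_cases hN D hk i i' hi'.2 hne
    rw [Finset.mem_union, hF1, hF2, Finset.mem_filter, Finset.mem_filter]
    rcases hcases with hs | ht
    · left; refine ⟨Finset.mem_univ _, hi'.2, hdir, ?_⟩
      have h1 : iterBlockOf (lvl hN D hk i') x₀ = i'.1.2.src := by have := hs hx₀; rwa [mem_iterBlock] at this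
      unfold srcBlk
      show iterBlock (lvl hN D hk i') i'.1.2.src = (fun n => iterBlock n (iterBlockOf n x₀)) (j + 1)
      rw [← hi'.2]
      show iterBlock (lvl hN D hk i') i'.1.2.src = iterBlock (lvl hN D hk i') (iterBlockOf (lvl hN D hk i') x₀)
      rw [h1]
    · right; refine ⟨Finset.mem_univ _, hi'.2, hdir, ?_⟩
      have h1 : iterBlockOf (lvl hN D hk i') x₀ = i'.1.2.tgt := by have := ht hx₀; rwa [mem_iterBlock] at this
      show iterBlock (lvl hN D hk i') i'.1.2.tgt = (fun n => iterBlock n (iterBlockOf n x₀)) (j + 1)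
      rw [← hi'.2]
      show iterBlock (lvl hN D hk i') i'.1.2.tgt = iterBlock (lvl hN D hk i') (iterBlockOf (lvl hN D hk i') x₀)
      rw [h1]
  -- step 2: the base block lies in the key block
  have hsubK : iterBlock j (base hN D hk i) ⊆ iterBlock (j + 1) (iterBlockOf (j + 1) x₀) := by
    intro z hz
    rw [mem_iterBlock] at hz ⊢
    exact iterBlockOf_eq_of_le (Nat.le_succ j) (hz.trans (iterBlockOf_baseSite hN D hk i).symm)
  -- step 3: the values on `F1` and `F2`
  have hv1 : ∀ i' ∈ F1, QE (domT hN D hk) (bump hN D hk i) i' = cQ (d := d) (ℓ := ℓ) (j + 1) * (S * upos hN D hk i + ctr hN D hk i + 1) * M := by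
    intro i' hi'
    rw [hF1, Finset.mem_filter] at hi'
    obtain ⟨-, hj', hdir, hkey⟩ := hi'
    have hperi' : 2 ≤ (PV d ℓ m K hd hL).sitesPerDir (lvl hN D hk i') := by rw [hj']; exact hper'
    have e := coarse_pair_src hN D hk i i' hperi' hj' hdir (by unfold srcBlk at hkey; rw [hkey]; exact hsubK)
    rw [e, hSdef, hMdef]; ring
  have hv2 : ∀ i' ∈ F2, QE (domT hN D hk) (bump hN D hk i) i' = cQ (d := d) (ℓ := ℓ) (j + 1) * (S' - 1 - S * upos hN D hk i - ctr hN D hk i) * M := by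
    intro i' hi'
    rw [hF2, Finset.mem_filter] at hi'
    obtain ⟨-, hj', hdir, hkey⟩ := hi'
    have hperi' : 2 ≤ (PV d ℓ m K hd hL).sitesPerDir (lvl hN D hk i') := by rw [hj']; exact hper'
    have e := coarse_pair_tgt hN D hk i i' hperi' hj' hdir (by rw [hkey]; exact hsubK)
    rw [e, hSdef, hS'def, hMdef]; ring
  -- step 4: at most one row of each type
  have hc1 : F1.card ≤ 1 := card_key_le_one hN D hk (j + 1) μ _
  have hc2 : F2.card ≤ 1 := by
    refine Finset.card_le_one.2 fun a ha b hb => ?_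
    rw [hF2, Finset.mem_filter] at ha hb
    exact eq_of_tgt_block_eq hN D hk (ha.2.1.trans hb.2.1.symm) (ha.2.2.1.trans hb.2.2.1.symm) (ha.2.2.2.trans hb.2.2.2.symm)
  -- step 5: the two values are nonnegative and add up to `c_Q·S′·M`
  have hcS : (ctr hN D hk i : ℝ) + 1 ≤ S := by
    have : ctr hN D hk i + 1 ≤ (ℓ + 1) ^ j := by
      rw [hjdef]; have := (ctr_fit' hN D hk i).2; have := one_le_erad hN D hk i; omega
    rw [hSdef]; exact_mod_cast this
  have hSS : S * (upos hN D hk i + 1) ≤ S' := by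
    have h := Nat.mul_le_mul_left ((ℓ + 1) ^ j) (upos_lt hN D hk i : upos hN D hk i + 1 ≤ ℓ + 1)
    rw [← pow_succ] at h
    rw [hSdef, hS'def]; exact_mod_cast h
  have hu0 : (0 : ℝ) ≤ upos hN D hk i := Nat.cast_nonneg _
  have hct0 : (0 : ℝ) ≤ ctr hN D hk i := Nat.cast_nonneg _
  have hS0 : (0 : ℝ) ≤ S := Nat.cast_nonneg _
  have hval1 : 0 ≤ cQ (d := d) (ℓ := ℓ) (j + 1) * (S * upos hN D hk i + ctr hN D hk i + 1) * M := by positivity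
  have hval2 : 0 ≤ cQ (d := d) (ℓ := ℓ) (j + 1) * (S' - 1 - S * upos hN D hk i - ctr hN D hk i) * M :=
    mul_nonneg (mul_nonneg hc.le (by nlinarith)) hM0
  -- step 6: assemble
  have hs1 : ∑ i' ∈ F1, QE (domT hN D hk) (bump hN D hk i) i' ≤ cQ (d := d) (ℓ := ℓ) (j + 1) * (S * upos hN D hk i + ctr hN D hk i + 1) * M := by
    rw [Finset.sum_congr rfl hv1, Finset.sum_const, nsmul_eq_mul]
    have : (F1.card : ℝ) ≤ 1 := by exact_mod_cast hc1
    nlinarith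
  have hs2 : ∑ i' ∈ F2, QE (domT hN D hk) (bump hN D hk i) i' ≤ cQ (d := d) (ℓ := ℓ) (j + 1) * (S' - 1 - S * upos hN D hk i - ctr hN D hk i) * M := by
    rw [Finset.sum_congr rfl hv2, Finset.sum_const, nsmul_eq_mul]
    have : (F2.card : ℝ) ≤ 1 := by exact_mod_cast hc2
    nlinarith
  have hnn : ∀ i', 0 ≤ QE (domT hN D hk) (bump hN D hk i) i' := fun i' => pair_nonneg hN D hk i i'
  calc ∑ i' ∈ F, QE (domT hN D hk) (bump hN D hk i) i'
      = ∑ i' ∈ F.filter (fun i' => QE (domT hN D hk) (bump hN D hk i) i' ≠ 0), QE (domT hN D hk) (bump hN D hk i) i' :=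
        (Finset.sum_filter_ne_zero _).symm
    _ ≤ ∑ i' ∈ F1 ∪ F2, QE (domT hN D hk) (bump hN D hk i) i' :=
        Finset.sum_le_sum_of_subset_of_nonneg (fun i' hi' => by rw [Finset.mem_filter] at hi'; exact hmem i' hi'.1 hi'.2)
          fun i' _ _ => hnn i'
    _ ≤ ∑ i' ∈ F1, QE (domT hN D hk) (bump hN D hk i) i' + ∑ i' ∈ F2, QE (domT hN D hk) (bump hN D hk i) i' := by
        rw [← Finset.sum_union_inter]
        have : 0 ≤ ∑ i' ∈ F1 ∩ F2, QE (domT hN D hk) (bump hN D hk i) i' := Finset.sum_nonneg fun i' _ => hnn i'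
        linarith
    _ ≤ cQ (d := d) (ℓ := ℓ) (j + 1) * (S * upos hN D hk i + ctr hN D hk i + 1) * M +
        cQ (d := d) (ℓ := ℓ) (j + 1) * (S' - 1 - S * upos hN D hk i - ctr hN D hk i) * M := add_le_add hs1 hs2
    _ = cQ (d := d) (ℓ := ℓ) (j + 1) * S' * tsumL hN D hk i * Tsum (ℓ := ℓ) j ^ d := by rw [hMdef]; ring

/-- **AT MOST `L^D` FINE BUMPS ARE SEEN BY ONE COARSE ROW** when `R·M̂ ≥ 3` (only case-A bumps, keyed by their source block: disjoint `j`-blocks of the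
non-base end block of the row). [cite: Balaban1984PropagatorsII, (2.147) p.248, (2.1)–(2.3) p.224, bookkeeping] -/
theorem card_fine_seen_le' (hRM : 3 ≤ R * Mh) (i' : BondIdx (domT hN D hk)) :
    (Finset.univ.filter fun i : BondIdx (domT hN D hk) => lvl hN D hk i' = lvl hN D hk i + 1 ∧ QE (domT hN D hk) (bump hN D hk i) i' ≠ 0).card ≤
      (ℓ + 1) ^ (d + 1) := by
  classical
  rcases Nat.eq_zero_or_pos (lvl hN D hk i') with hj0 | hj1
  · refine le_trans (le_of_eq (Finset.card_eq_zero.2 (Finset.filter_eq_empty_iff.2 fun i _ h => ?_))) (Nat.zero_le _)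
    have := h.1; omega
  set j' := lvl hN D hk i'
  set j := j' - 1 with hjdef
  set μ := i'.1.2.dir
  set T := iterBlock j' (other hN D hk i')
  have hj'm : j' ≤ m + K := lvl_le_mK hN D hk i'
  set FA := Finset.univ.filter fun i : BondIdx (domT hN D hk) => lvl hN D hk i = j ∧ i.1.2.dir = μ ∧ srcBlk hN D hk i ⊆ T
  have hsub : (Finset.univ.filter fun i : BondIdx (domT hN D hk) => lvl hN D hk i' = lvl hN D hk i + 1 ∧ QE (domT hN D hk) (bump hN D hk i) i' ≠ 0) ⊆ FA := by
    intro i hi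
    rw [Finset.mem_filter] at hi
    obtain ⟨-, hji, hne⟩ := hi
    have hlv : lvl hN D hk i = j := by omega
    have hdir := (witness_of_pair_ne_zero hN D hk i i' hne).1
    have hsubT := baseBlk_subset_other hN D hk i i' hji hne
    have hA := caseA_of_coarse_pair_ne_zero hN D hk hRM i i' hji hne
    rw [Finset.mem_filter]
    refine ⟨Finset.mem_univ _, hlv, hdir.symm, ?_⟩
    unfold srcBlk; rwa [base_eq_src_of hN D hk i hA] at hsubT
  have hT : T.card = ((ℓ + 1) ^ (d + 1)) ^ j' := card_iterBlock _ hj'm _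
  have hpow : ((ℓ + 1) ^ (d + 1)) ^ j' = ((ℓ + 1) ^ (d + 1)) ^ j * (ℓ + 1) ^ (d + 1) := by
    rw [← pow_succ]; congr 1; omega
  refine (Finset.card_le_card hsub).trans ?_
  -- disjoint-blocks counting inside `T`
  have hcard : ∀ i ∈ FA, (srcBlk hN D hk i).card = ((ℓ + 1) ^ (d + 1)) ^ j := by
    intro i hi
    have hlv := (Finset.mem_filter.1 hi).2.1
    unfold srcBlk; rw [card_iterBlock _ (lvl_le_mK hN D hk i), hlv]
  have hdisj : ∀ i ∈ FA, ∀ i₂ ∈ FA, i ≠ i₂ → Disjoint (srcBlk hN D hk i) (srcBlk hN D hk i₂) := by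
    intro i hi i₂ hi₂ hne
    have h1 := Finset.mem_filter.1 hi
    have h2 := Finset.mem_filter.1 hi₂
    rw [Finset.disjoint_left]
    intro x hx hx2
    apply hne
    refine ext_of_key hN D hk (h1.2.1.trans h2.2.1.symm) (h1.2.2.1.trans h2.2.2.1.symm) ?_
    unfold srcBlk at hx hx2 ⊢
    rw [mem_iterBlock] at hx hx2
    obtain ⟨⟨j₁, b₁⟩, hb₁⟩ := i
    obtain ⟨⟨j₂, b₂⟩, hb₂⟩ := i₂
    have hjj : j₁ = j₂ := Fin.ext (by have := h1.2.1.trans h2.2.1.symm; simpa [lvl] using this)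
    subst hjj
    simp only [lvl] at hx hx2 ⊢
    rw [← hx, ← hx2]
  have h1 : (FA.biUnion (srcBlk hN D hk)).card = FA.card * ((ℓ + 1) ^ (d + 1)) ^ j := by
    rw [Finset.card_biUnion hdisj, Finset.sum_congr rfl hcard, Finset.sum_const, smul_eq_mul]
  have h2 : (FA.biUnion (srcBlk hN D hk)).card ≤ T.card :=
    Finset.card_le_card (Finset.biUnion_subset.2 fun i hi => (Finset.mem_filter.1 hi).2.2.2)
  rw [h1, hT, hpow] at h2
  have h3 : FA.card * ((ℓ + 1) ^ (d + 1)) ^ j ≤ (ℓ + 1) ^ (d + 1) * ((ℓ + 1) ^ (d + 1)) ^ j := by rw [mul_comm ((ℓ + 1) ^ (d + 1))]; exact h2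
  exact Nat.le_of_mul_le_mul_right h3 (by positivity)

end Coarse

end

end Literature.MathematicalPhysics.QuantumFieldTheory.Balaban1983to89.B6QGQTestBumpsKLevelV1L3
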